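import Mathlib
import HarnessLib
import Literature.Analysis.FluidPDE.Tao2016AveragedNS.LocalCascadeSolutions
import Literature.Analysis.FluidPDE.Tao2016AveragedNS.RenormalisedCascadeWaves
import Literature.Analysis.FluidPDE.Tao2016AveragedNS.SelfSimilarCascadeBlowup
import Summits.NavierStokesRegularity.NavierStokesRegularity.Theorems.TaoLadderRungTwoBreakEternalRigidityViscBddOneDefs
import Summits.NavierStokesRegularity.NavierStokesRegularity.Theorems.WakeRatchetMinimalViscousBlowupMaximalBlowup

/-!
# Route `TaoLadderRungTwoBreak`, crux `EternalRigidityViscBddOne` (stmt-NavierStokesRegularity-20420):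
# registered stub `stub_viscousBlowup` (ω1) of the birth skeleton `EternalRigidityViscBddOne_birth.lean`
# (sha16 `85fbfe8e90eea58b`) closed BY NAME

Stub (ω1) of the K2ᵛ(1) skeleton: κ-blow-up (`¬ HasGlobal ε₀ α κ κ 0 X₀`: no global `(κ,κ)`-pseudo-solution from
the one-shell datum) with `ν√2 ≤ κ`, `ν > 0`, forces the exact `ν`-viscous NS-scaled lattice of the table `α` to
have a MAXIMAL regular solution on some `[0, t⋆)` whose (4.5)-weighted norm blows up at `t⋆`
(`ViscousUpTo ε₀ ν α X₀ X t⋆ ∧ BlowsUpAt ε₀ X t⋆`, the Theorems-side twins of the skeleton's vocabulary,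
module `…TaoLadderRungTwoBreakEternalRigidityViscBddOneDefs`).

PROOF.  (a) A global regular viscous solution would be a `(ν√2, 0)`-pseudo-solution (tree
`hasGlobal_of_viscousGlobal`), hence a `(κ, κ)` one (`hasGlobal_mono`) — excluded; (b) with no global regular
solution, the tree's maximal-solution / blow-up-alternative theorem for the viscous lattice
(`MinimalViscousBlowup.ThresholdRay.maximalBlowup`, route WakeRatchet, p·`…MaximalBlowup`; Duhamel–Picard local
theory `ViscousLatticeFlows` + uniqueness `viscousFlow_unique`) delivers the six clauses of `ViscousUpTo` and
`BlowsUpAt` up to the order of binders.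

HONEST LABEL: size-M stub, closed by assembling tree theorems; MODEL lattice ODEs of Tao 2016 §4 only; the
stubs `stub_typeOne` (ω3) / `stub_eternalLimitViscBdd` (ω4) of the same skeleton, the crux 20420 and every NS
statement remain OPEN; nothing here bears on the summit.
-/

noncomputable section

-- the summit and its single sub-problem share the name (CONVENTIONS §1)
set_option linter.dupNamespace false

namespace Summit.NavierStokesRegularity.NavierStokesRegularity.Theorems.EternalRigidityViscBddOne.Birth

open Set
open Literature.Analysis.FluidPDE Literature.Analysis.FluidPDE.TaoCascade

/-- **No global regular viscous solution under κ-blow-up.**  If `0 ≤ ν`, `ν√2 ≤ κ` and the table admits no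
global `(κ, κ)`-pseudo-solution from the one-shell datum `X₀` at shell `0`, then the exact `ν`-viscous lattice
has no global regular solution from `X₀` (a global regular viscous solution is a `(ν√2, 0)`-pseudo-solution,
`hasGlobal_of_viscousGlobal`, and pseudo-solutions are monotone in the defect constants, `hasGlobal_mono`).
[cite: Tao2016AveragedNS, §4 Lemma 4.1 (4.5)–(4.11) with the remark after (4.11) (the viscous term as a defect)] -/
theorem not_exists_viscousGlobal_of_not_hasGlobal {ε₀ κ ν : ℝ} (hε₀ : 0 < ε₀) (hν : 0 ≤ ν)
    (hνκ : ν * Real.sqrt 2 ≤ κ) {α : Fin 4 → Fin 4 → Fin 4 → ℤ × ℤ × ℤ → ℝ} {X₀ : Fin 4 → ℝ}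
    (hnot : ¬ HasGlobal ε₀ α κ κ 0 X₀) :
    ¬ ∃ X : Fin 4 → ℤ → ℝ → ℝ, ViscousGlobal ε₀ ν α X₀ X := by
  rintro ⟨X, hX⟩
  have h2 : (0 : ℝ) ≤ ν * Real.sqrt 2 := mul_nonneg hν (Real.sqrt_nonneg _)
  exact hnot (hasGlobal_mono hε₀.le (hasGlobal_of_viscousGlobal hε₀ hν hX) hνκ (h2.trans hνκ))

/-- **Registered stub `stub_viscousBlowup` (ω1) of crux `EternalRigidityViscBddOne` (skeleton `85fbfe8e90eea58b`),
signature verbatim**: κ-blow-up with `ν√2 ≤ κ`, `ν > 0`, gives a maximal regular solution of the exact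
`ν`-viscous lattice on some `[0, t⋆)` that blows up (in the (4.5)-weighted norm) at `t⋆`.  Assembled from
`not_exists_viscousGlobal_of_not_hasGlobal` and the tree's `MinimalViscousBlowup.ThresholdRay.maximalBlowup`.
[cite: Tao2016AveragedNS, §4 (the viscous lattice before Thm. 4.2; Lemma 4.1 (4.5), (4.7), (4.11)); Teschl2012, §2.6 Cor. 2.16 (maximal solutions and the blow-up alternative)] -/
theorem stub_viscousBlowup : ∀ R : ℝ, 1 ≤ R → ∀ ε₀ : ℝ, 0 < ε₀ → ∀ (α : Fin 4 → Fin 4 → Fin 4 → ℤ × ℤ × ℤ → ℝ) (X₀ : Fin 4 → ℝ), InTableClass R α → ∀ κ ν : ℝ, 0 < ν → ν * Real.sqrt 2 ≤ κ → ¬ HasGlobal ε₀ α κ κ 0 X₀ → ∃ (X : Fin 4 → ℤ → ℝ → ℝ) (tStar : ℝ), ViscousUpTo ε₀ ν α X₀ X tStar ∧ BlowsUpAt ε₀ X tStar := by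
  intro R hR ε₀ hε₀ α X₀ hα κ ν hν hνκ hnot
  obtain ⟨T, X, hT, hC1, hinit, hlow, hmot, hreg, hblow⟩ :=
    MinimalViscousBlowup.ThresholdRay.maximalBlowup ε₀ hε₀ R hR α X₀ hα ν hν
      (not_exists_viscousGlobal_of_not_hasGlobal hε₀ hν.le hνκ hnot)
  refine ⟨X, T, ?_, fun M => ?_⟩
  · exact
      { pos := hT
        contDiffOn := hC1
        apriori := fun T' hT' hT'T => by
          obtain ⟨M, hM⟩ := hreg T' hT' hT'T
          exact ⟨M, fun t ht i n => hM t ht.1 ht.2 i n⟩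
        init := hinit
        motion := hmot
        noLow := fun i n t hn _ _ => hlow i n t hn }
  · exact hblow M

end Summit.NavierStokesRegularity.NavierStokesRegularity.Theorems.EternalRigidityViscBddOne.Birth

end
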